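import Summits.Ventures.QEC.CircuitDistance.PortK2Complete
import HarnessLib

/-!
# P3-PORT (K2c): a KERNEL-CHEAP instance check `check₂` with INDEX DATA (closure indices, stop-witness index lists) and
# LIST COMPLETENESS from `Good` (cell `qec`, experiment CDX, seat qec-cdx-type-1)

`K2Inst.check` searches (`any`) for translation partners and tests every stop mask bit against word membership —
`O(N²)` resp. `O(#T · N · |word|)` finset comparisons (≈ 0.5 ms each in the kernel; too slow at `[[144,12,12]]`, 199 witnesses).
`check₂` takes the partner indices `closIdx` and, per stop mask, the index list `ns` of the translated word as DATA and verifies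
them directly (`G (closIdx t n) = trQ t (G n)`, `msk = lmask ns`, `ns.map G = word`); `good_of_check₂ : check₂ = true → Good` and
`k2_completeG` (= `k2_complete` from `Good`) give the binder exactly as before.
-/

namespace Summit.Ventures.QEC.CircuitDistance

open Literature.InformationTheory.QuantumCodes Finset K2

variable {ℓ m : ℕ}

/-- Bitmask of an index list. -/
def lmask : List ℕ → ℕ
  | [] => 0
  | a :: as => lmask as ||| 2 ^ a

/-- Bits of `lmask`. -/
theorem testBit_lmask : ∀ (ns : List ℕ) (n : ℕ), (lmask ns).testBit n = decide (n ∈ ns)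
  | [], n => by unfold lmask; rw [Nat.zero_testBit]; simp
  | a :: as, n => by
    unfold lmask
    rw [Nat.testBit_or, testBit_lmask as n, Nat.testBit_two_pow]
    by_cases h1 : n ∈ as <;> by_cases h2 : a = n <;> simp [h1, h2, eq_comm]

namespace K2Inst

variable [NeZero ℓ] [NeZero m]

/-- THE KERNEL-CHEAP CONSISTENCY CHECK with index data. -/
def check₂ (I : K2Inst ℓ m) (H : BB.Mono ℓ m → (BB.Mono ℓ m ⊕ BB.Mono ℓ m) → ZMod 2)
    (words : List (List (Finset (BB.Mono ℓ m ⊕ BB.Mono ℓ m)))) (closIdx : List (List ℕ))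
    (witIdx : List (List (List ℕ))) : Bool :=
  let N := I.D.N
  let C := I.D.C
  let K := I.Ts.length
  decide (N = I.gsupp.length) && decide (N = K * C) && decide (I.lives.length = K) && decide (I.wit.length = K) &&
  decide (0 < C) && decide ((monoList ℓ m).length = C) && decide I.gsupp.Nodup && I.D.wfCheck && I.D.z0Check &&
  ((List.range N).all fun n => (List.range C).all fun c =>
    match (monoList ℓ m)[c]? with
    | none => false
    | some j => (I.D.synOf n).testBit c == synSem H (I.G n) j) &&
  ((List.range N).all fun n => (List.range I.lsupp.length).all fun j =>
    (I.D.lgOf n).testBit j == lgSem (I.lsupp.getD j ∅) (I.G n)) &&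
  ((List.range K).all fun k => (List.range N).all fun n =>
    (I.lives.getD k 0).testBit n == (decide (C * k ≤ n) && !(n == C * k))) &&
  -- closure under the two generating translations via the index table
  ((List.range 2).all fun ti =>
    let t : BB.Mono ℓ m := if ti = 0 then ((1 : Fin ℓ), (0 : Fin m)) else ((0 : Fin ℓ), (1 : Fin m))
    (List.range N).all fun n =>
      let n' := (closIdx.getD ti []).getD n 0
      decide (n' < N) && decide (I.G n' = trQ t (I.G n)) && (n' / C == n / C)) &&
  ((List.range N).all fun n => (monoList ℓ m).any fun t => decide (trQ t (I.G n) = I.G (C * (n / C)))) &&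
  -- stop witnesses via index lists
  ((List.range K).all fun k =>
    decide ((I.Ts.getD k []).length = (I.wit.getD k []).length) &&
    (List.range (I.Ts.getD k []).length).all fun i =>
      let msk := (I.Ts.getD k []).getD i 0
      let et := (I.wit.getD k []).getD i (0, 0)
      let ns := (witIdx.getD k []).getD i []
      decide (et.1 < words.length) && (ns.all fun n => decide (n < N)) && decide (msk = lmask ns) &&
      decide (ns.map I.G = (words.getD et.1 []).map (trQ et.2)))

/-- `check₂ = true` unpacks to `Good`. -/
theorem good_of_check₂ (I : K2Inst ℓ m) (H : BB.Mono ℓ m → (BB.Mono ℓ m ⊕ BB.Mono ℓ m) → ZMod 2)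
    (words : List (List (Finset (BB.Mono ℓ m ⊕ BB.Mono ℓ m)))) (closIdx : List (List ℕ)) (witIdx : List (List (List ℕ)))
    (h : I.check₂ H words closIdx witIdx = true) : I.Good H words := by
  unfold check₂ at h
  simp only [Bool.and_eq_true, decide_eq_true_eq, List.all_eq_true, List.any_eq_true, List.mem_range, beq_iff_eq] at h
  obtain ⟨⟨⟨⟨⟨⟨⟨⟨⟨⟨⟨⟨⟨⟨hN, hNK⟩, hlives⟩, hwit⟩, hC⟩, hmono⟩, hnodup⟩, hwf⟩, hz0⟩, hsyn⟩, hlg⟩, hlive⟩, hclos⟩, hpiv⟩,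
    hwitok⟩ := h
  -- injectivity of `G` below `N`
  have hGinj : ∀ {n n' : ℕ}, n < I.D.N → n' < I.D.N → I.G n = I.G n' → n = n' := by
    intro n n' hn hn' h
    unfold G at h
    rw [hN] at hn hn'
    rw [List.getD_eq_getElem _ _ hn, List.getD_eq_getElem _ _ hn'] at h
    exact (hnodup.getElem_inj_iff).1 h
  have hGmem : ∀ {n : ℕ}, n < I.D.N → I.G n ∈ I.gsupp := by
    intro n hn; unfold G; rw [hN] at hn; rw [List.getD_eq_getElem _ _ hn]; exact List.getElem_mem hn
  refine ⟨hN, hNK, hlives, hC, hmono, hnodup, I.D.wf_of_check hwf, hz0, ?_, ?_, ?_, ?_, ?_, ?_⟩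
  · intro n hn c hc
    have := hsyn n hn c (by omega)
    rw [List.getElem?_eq_getElem hc] at this
    simpa using this
  · intro n hn j hj; exact hlg n hn j hj
  · intro k hk n hn; exact hlive k hk n hn
  · intro t ht n hn
    simp only [List.mem_cons, List.mem_nil_iff, or_false] at ht
    rcases ht with rfl | rfl
    · obtain ⟨⟨h1, h2⟩, h3⟩ := hclos 0 (by norm_num) n hn
      exact ⟨_, h1, by simpa using h2, h3⟩
    · obtain ⟨⟨h1, h2⟩, h3⟩ := hclos 1 (by norm_num) n hn
      exact ⟨_, h1, by simpa using h2, h3⟩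
  · intro n hn
    obtain ⟨t, _, ht⟩ := hpiv n hn
    exact ⟨t, ht⟩
  · intro k hk msk hmsk
    obtain ⟨hlen, hall⟩ := hwitok k hk
    obtain ⟨i, hi, rfl⟩ := List.mem_iff_getElem.1 hmsk
    obtain ⟨⟨⟨he, hns⟩, hm⟩, hmap⟩ := hall i hi
    rw [List.getD_eq_getElem _ _ hi] at hm
    refine ⟨((I.wit.getD k []).getD i (0, 0)).1, he, ((I.wit.getD k []).getD i (0, 0)).2, fun g hg => ?_, fun n hn => ?_⟩
    · rw [← hmap] at hg
      obtain ⟨n', hn', rfl⟩ := List.mem_map.1 hg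
      exact hGmem (hns n' hn')
    · rw [hm, testBit_lmask]
      apply decide_eq_decide.mpr
      constructor
      · intro hn'
        rw [← hmap]; exact List.mem_map.2 ⟨n, hn', rfl⟩
      · intro hg
        rw [← hmap] at hg
        obtain ⟨n', hn'', he'⟩ := List.mem_map.1 hg
        rwa [← hGinj (hns n' hn'') hn he']

variable {I : K2Inst ℓ m} {H : BB.Mono ℓ m → (BB.Mono ℓ m ⊕ BB.Mono ℓ m) → ZMod 2}
  {words : List (List (Finset (BB.Mono ℓ m ⊕ BB.Mono ℓ m)))}

section Main

variable {Hs : Matrix (BB.Mono ℓ m) (BB.Mono ℓ m ⊕ BB.Mono ℓ m) (ZMod 2)}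

/-- **LIST COMPLETENESS from `Good`** (the body of `k2_complete`). -/
theorem k2_completeG (hg : I.Good H words)
    (hcubes : ∀ k < I.Ts.length, I.D.cube (I.Ts.getD k []) (I.D.C * k) (I.lives.getD k 0) = true)
    (hH : ∀ (v : BB.Mono ℓ m ⊕ BB.Mono ℓ m → ZMod 2) (t j : BB.Mono ℓ m),
      Matrix.mulVec H (fun q => v ((BB.Code.translate t).symm q)) j = Matrix.mulVec H v (j - t))
    (hHs : ∀ (v : BB.Mono ℓ m ⊕ BB.Mono ℓ m → ZMod 2) (t : BB.Mono ℓ m),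
      v ∈ rowSpace Hs → (fun q => v ((BB.Code.translate t).symm q)) ∈ rowSpace Hs)
    (hlog : ∀ v, Matrix.mulVec H v = 0 → v ∉ rowSpace Hs → ∃ s ∈ I.lsupp, indic s ⬝ᵥ v ≠ 0)
    (x : Finset (Finset (BB.Mono ℓ m ⊕ BB.Mono ℓ m))) (hx : ∀ g ∈ x, g ∈ I.gsupp)
    (hz : Matrix.mulVec H (∑ g ∈ x, indic g) = 0) (hn : (∑ g ∈ x, indic g) ∉ rowSpace Hs)
    (hcard : x.card ≤ I.D.w) :
    ∃ wd ∈ words, ∃ t : BB.Mono ℓ m, x = (wd.map (trQ t)).toFinset := by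
  have hne : x.Nonempty := by
    rw [Finset.nonempty_iff_ne_empty]; rintro rfl; apply hn; rw [Finset.sum_empty]; exact Submodule.zero_mem _
  obtain ⟨t, k, hk, S, hx', hS, hSne, hSz, hstop⟩ := pivot_step hg hcubes hH hx hz hne hcard
  have hcardx' : (x.image (trQ t)).card = x.card := Finset.card_image_of_injective _ (trQ_injective t)
  have hixlt : ∀ n ∈ I.ixOf (x.image (trQ t)), n < I.D.N := fun n hn' => (mem_ixOf.1 hn').1
  have hixS : ∀ n ∈ S, n < I.D.N := fun n hn' => hixlt n (hS hn')
  have hx'z := nontriv_translate hH hHs hz hn t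
  rw [← sum_indic_image_trQ] at hx'z
  have hS3 : 3 ≤ S.card := I.D.three_le_card_of_zeroSyn hg.z0 hixS hSz hSne
  rcases hstop with hl | ⟨hwS, msk, hmsk, hmask⟩
  · exfalso
    have hyx : S.image I.G ⊆ x.image (trQ t) := fun g hg' => by
      obtain ⟨n, hn', rfl⟩ := Finset.mem_image.1 hg'; exact (mem_ixOf.1 (hS hn')).2
    have hycard : (S.image I.G).card = S.card := Finset.card_image_of_injOn (G_injOn hg hixS)
    have hyrs : (∑ g ∈ S.image I.G, indic g) ∈ rowSpace Hs := by
      rw [← vecOf_eq_sum_image hg hixS]; exact mem_rowSpace_of_lgZero hg hlog hixS hSz hl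
    have hyz : Matrix.mulVec H (∑ g ∈ S.image I.G, indic g) = 0 := by
      rw [← vecOf_eq_sum_image hg hixS]; exact (zeroSyn_iff hg hixS).1 hSz
    have hsum : (∑ g ∈ x.image (trQ t) \ S.image I.G, indic g) =
        (∑ g ∈ x.image (trQ t), indic g) - ∑ g ∈ S.image I.G, indic g := by
      rw [eq_sub_iff_add_eq, Finset.sum_sdiff hyx]
    have h1 : Matrix.mulVec H (∑ g ∈ x.image (trQ t) \ S.image I.G, indic g) = 0 := by
      rw [hsum, Matrix.mulVec_sub, hx'z.1, hyz, sub_zero]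
    have h2 : (∑ g ∈ x.image (trQ t) \ S.image I.G, indic g) ∉ rowSpace Hs := fun h => hx'z.2 (by
      have := Submodule.add_mem _ h hyrs; rwa [hsum, sub_add_cancel] at this)
    have hc := Finset.card_sdiff_add_card_eq_card hyx
    rw [hycard, hcardx'] at hc
    have := w_le_card_succ hg hcubes hH hHs hlog _ (x.image (trQ t) \ S.image I.G) rfl
      (fun g hg' => hx' g (Finset.mem_sdiff.1 hg').1) h1 h2
    have : S.card ≤ x.card := (Finset.card_le_card hS).trans (by rw [card_ixOf hg hx', hcardx'])
    omega
  · -- the stop set is the whole index word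
    have hzs' : I.D.ZeroSyn (I.ixOf (x.image (trQ t))) := by
      rw [zeroSyn_iff hg hixlt, vecOf_ixOf hg hx']; exact hx'z.1
    have hSeq : S = I.ixOf (x.image (trQ t)) := by
      by_contra hne'
      have hdne : (I.ixOf (x.image (trQ t)) \ S).Nonempty := by
        rw [Finset.sdiff_nonempty]; exact fun h => hne' (Finset.Subset.antisymm hS h)
      have h3 := I.D.three_le_card_of_zeroSyn hg.z0 (fun n hn' => hixlt n (Finset.mem_sdiff.1 hn').1)
        (I.D.zeroSyn_sdiff hS hzs' hSz) hdne
      have hc := Finset.card_sdiff_add_card_eq_card hS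
      rw [card_ixOf hg hx', hcardx'] at hc
      omega
    obtain ⟨e, he, t₁, hwg, hbits⟩ := hg.wit_ok k hk msk hmsk
    have hx'eq : ∀ g, g ∈ x.image (trQ t) ↔ g ∈ (words.getD e []).map (trQ t₁) := by
      intro g
      constructor
      · intro hg'
        obtain ⟨n, hn', rfl⟩ := exists_idx hg (hx' g hg')
        have hnS : n ∈ S := by rw [hSeq]; exact mem_ixOf.2 ⟨hn', hg'⟩
        have := hmask n
        rw [hbits n hn', decide_eq_true hnS, decide_eq_true_iff] at this
        exact this
      · intro hg'
        obtain ⟨n, hn', rfl⟩ := exists_idx hg (hwg _ hg')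
        have := hmask n
        rw [hbits n hn', decide_eq_true hg'] at this
        have hnS : n ∈ S := of_decide_eq_true this.symm
        rw [hSeq] at hnS
        exact (mem_ixOf.1 hnS).2
    refine ⟨words.getD e [], ?_, t₁ + -t, ?_⟩
    · rw [List.getD_eq_getElem _ _ he]; exact List.getElem_mem he
    · ext g
      rw [List.mem_toFinset, List.mem_map]
      constructor
      · intro hgx
        have : trQ t g ∈ (words.getD e []).map (trQ t₁) := (hx'eq _).1 (Finset.mem_image_of_mem _ hgx)
        obtain ⟨a, ha, hag⟩ := List.mem_map.1 this
        exact ⟨a, ha, by rw [trQ_add, hag, trQ_neg_trQ]⟩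
      · rintro ⟨a, ha, rfl⟩
        have : trQ t₁ a ∈ x.image (trQ t) := (hx'eq _).2 (List.mem_map.2 ⟨a, ha, rfl⟩)
        obtain ⟨g₁, hg₁, hg₁'⟩ := Finset.mem_image.1 this
        rw [trQ_add, ← hg₁', trQ_neg_trQ]; exact hg₁

end Main

end K2Inst

end Summit.Ventures.QEC.CircuitDistance
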